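import Literature.Analysis.Potential.RieszKernelPairingSubordination
import Mathlib.Analysis.SpecialFunctions.Pow.Integral
import Mathlib.MeasureTheory.Group.LIntegral
import HarnessLib

/-!
# A local `L²` bound for the Riesz energy `∬ u(x) |x − y|^{-α} u(y)` on `ℝ³`

Analysis/Potential support file (everything proved; no definitions, no named facts).  For
`0 ≤ α < 3`, a radius `R` and real Schwartz functions `u` supported in the closed ball `B̄(0, R)`,

  `|∬ u(x) |x − y|^{-α} u(y) dx dy| ≤ C(α, R) · ∫ u(x)² dx`,  `C(α, R) = ∫_{|z| < 2|R|+1} |z|^{-α} dz`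

(`rieszEnergy_le_mul_integral_sq`).  Proof: `|u(x)||u(y)| ≤ (u(x)² + u(y)²)/2`, both points lie in
`B̄(0,R)` so `x − y ∈ B(0, 2|R|+1)`, and `∫_{B̄(0,R)} |x − y|^{-α} dy ≤ C(α, R)` (translation
invariance); Tonelli in `ℝ≥0∞` on the two halves.  This is the estimate that makes the covariance of
a generalised free field (two-point kernel `A|x − y|^{-2Δ}`, `2Δ < 3`) locally `L²`-bounded, the
hypothesis under which the germ and collar forms of the Markov property agree at balls (Rozanov 1982,
Ch. 2 §3.3 (3.15)); requested by the crux `GaussianLimitIsFree` of `CriticalPhenomena`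
(stub `stub_germToCollar`).

References: E. H. Lieb, M. Loss, *Analysis* (2001), §9.7–9.8 (Riesz potentials); N. S. Landkof,
*Foundations of Modern Potential Theory* (1972), Ch. I §1.
-/

noncomputable section

namespace Literature.Analysis.Potential

open MeasureTheory Set Filter Metric
open scoped ENNReal

/-- The Riesz kernel `|z|^{-α}`, `α < 3`, is integrable on every ball of `ℝ³` centred at the origin
(Mathlib's `integrableOn_ball_of_norm_le_rpow`). [folklore] -/
theorem integrableOn_rieszKernel_ball {α : ℝ} (h3 : α < 3) (ρ : ℝ) :
    IntegrableOn (fun z : EuclideanSpace ℝ (Fin 3) => ‖z‖ ^ (-α)) (ball 0 ρ) volume := by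
  have hd : Module.finrank ℝ (EuclideanSpace ℝ (Fin 3)) = 3 := finrank_euclideanSpace_fin
  refine integrableOn_ball_of_norm_le_rpow (by rw [hd]; norm_num) (C := 1) (α := α) (r := ρ)
    (by rw [hd]; exact_mod_cast h3) (Eventually.of_forall fun x => ?_)
    ((measurable_norm.pow_const _).aestronglyMeasurable)
  rw [one_mul, Real.norm_eq_abs, abs_of_nonneg (Real.rpow_nonneg (norm_nonneg _) _)]

/-- **Riesz potential of a ball, uniformly on the ball** (in `ℝ≥0∞`): for `x ∈ B̄(0,R)`,
`∫⁻_{B̄(0,R)} |x − y|^{-α} dy ≤ ∫_{|z| < 2|R|+1} |z|^{-α} dz` — substitute `z = x − y`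
(translation invariance of Lebesgue measure) and enlarge `x − B̄(0,R) ⊆ B(0, 2|R|+1)`. [folklore] -/
theorem lintegral_closedBall_rieszKernel_le {α : ℝ} (h3 : α < 3) {R : ℝ}
    {x : EuclideanSpace ℝ (Fin 3)} (hx : x ∈ closedBall (0 : EuclideanSpace ℝ (Fin 3)) R) :
    ∫⁻ y in closedBall (0 : EuclideanSpace ℝ (Fin 3)) R, ENNReal.ofReal (‖x - y‖ ^ (-α)) ≤
      ENNReal.ofReal (∫ z in ball (0 : EuclideanSpace ℝ (Fin 3)) (2 * |R| + 1), ‖z‖ ^ (-α)) := by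
  set ρ : ℝ := 2 * |R| + 1 with hρ
  set K : EuclideanSpace ℝ (Fin 3) → ℝ := fun z => ‖z‖ ^ (-α) with hK
  have hK0 : ∀ z, 0 ≤ K z := fun z => Real.rpow_nonneg (norm_nonneg _) _
  have hsub : ∀ y ∈ closedBall (0 : EuclideanSpace ℝ (Fin 3)) R,
      x - y ∈ ball (0 : EuclideanSpace ℝ (Fin 3)) ρ := by
    intro y hy
    rw [mem_closedBall, dist_zero_right] at hx hy
    rw [mem_ball, dist_zero_right]
    calc ‖x - y‖ ≤ ‖x‖ + ‖y‖ := norm_sub_le x y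
      _ ≤ R + R := add_le_add hx hy
      _ < ρ := by rw [hρ]; linarith [le_abs_self R]
  -- Step 1: dominate the restricted integrand by the translated indicator of the big ball
  have h1 : ∫⁻ y in closedBall (0 : EuclideanSpace ℝ (Fin 3)) R, ENNReal.ofReal (‖x - y‖ ^ (-α)) ≤
      ∫⁻ y, ENNReal.ofReal ((ball (0 : EuclideanSpace ℝ (Fin 3)) ρ).indicator K (x - y)) := by
    rw [← lintegral_indicator measurableSet_closedBall]
    refine lintegral_mono fun y => ?_
    by_cases hy : y ∈ closedBall (0 : EuclideanSpace ℝ (Fin 3)) R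
    · rw [indicator_of_mem hy, indicator_of_mem (hsub y hy)]
    · rw [indicator_of_notMem hy]
      exact zero_le
  -- Step 2: translation invariance and evaluation of the indicator integral
  have h2 : ∫⁻ y, ENNReal.ofReal ((ball (0 : EuclideanSpace ℝ (Fin 3)) ρ).indicator K (x - y)) =
      ∫⁻ z in ball (0 : EuclideanSpace ℝ (Fin 3)) ρ, ENNReal.ofReal (K z) := by
    rw [lintegral_sub_left_eq_self (fun z => ENNReal.ofReal ((ball (0 : EuclideanSpace ℝ (Fin 3)) ρ).indicator K z)) x,
      ← lintegral_indicator measurableSet_ball]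
    refine lintegral_congr fun z => ?_
    by_cases hz : z ∈ ball (0 : EuclideanSpace ℝ (Fin 3)) ρ
    · rw [indicator_of_mem hz, indicator_of_mem hz]
    · rw [indicator_of_notMem hz, indicator_of_notMem hz, ENNReal.ofReal_zero]
  have h3' : ∫⁻ z in ball (0 : EuclideanSpace ℝ (Fin 3)) ρ, ENNReal.ofReal (K z) =
      ENNReal.ofReal (∫ z in ball (0 : EuclideanSpace ℝ (Fin 3)) ρ, K z) :=
    (ofReal_integral_eq_lintegral_ofReal (integrableOn_rieszKernel_ball h3 ρ)
      (Eventually.of_forall fun z => hK0 z)).symm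
  exact h1.trans (h2.trans h3').le

/-- **Local `L²` bound for the Riesz energy on `ℝ³`.**  For `0 ≤ α < 3` and every `R` there is `C`
(namely `C = ∫_{|z|<2|R|+1} |z|^{-α} dz`) such that every real Schwartz `u` with
`tsupport u ⊆ B̄(0, R)` satisfies `|∬ u(x) |x − y|^{-α} u(y) dx dy| ≤ C · ∫ u²`.  Proof:
`|u(x)u(y)| ≤ (u(x)² + u(y)²)/2` on `B̄(0,R) × B̄(0,R)` (the integrand vanishes elsewhere), the
uniform potential bound `lintegral_closedBall_rieszKernel_le`, and Tonelli.
[cite: LiebLoss2001, Thm. 9.8] -/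
theorem rieszEnergy_le_mul_integral_sq {α : ℝ} (h0 : 0 ≤ α) (h3 : α < 3) (R : ℝ) :
    ∃ C : ℝ, 0 ≤ C ∧ ∀ u : SchwartzMap (EuclideanSpace ℝ (Fin 3)) ℝ,
      tsupport ⇑u ⊆ closedBall (0 : EuclideanSpace ℝ (Fin 3)) R →
        |∫ x, ∫ y, u x * ‖x - y‖ ^ (-α) * u y| ≤ C * ∫ x, (u x) ^ 2 := by
  set C : ℝ := ∫ z in ball (0 : EuclideanSpace ℝ (Fin 3)) (2 * |R| + 1), ‖z‖ ^ (-α) with hC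
  have hK0 : ∀ z : EuclideanSpace ℝ (Fin 3), 0 ≤ ‖z‖ ^ (-α) := fun z => Real.rpow_nonneg (norm_nonneg _) _
  have hC0 : 0 ≤ C := setIntegral_nonneg measurableSet_ball fun z _ => hK0 z
  refine ⟨C, hC0, fun u hu => ?_⟩
  set S : Set (EuclideanSpace ℝ (Fin 3)) := closedBall 0 R with hS
  have hu0 : ∀ x, x ∉ S → u x = 0 := fun x hx => image_eq_zero_of_notMem_tsupport fun h => hx (hu h)
  -- the integrand and its absolute value on the product space
  set F : EuclideanSpace ℝ (Fin 3) × EuclideanSpace ℝ (Fin 3) → ℝ :=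
    fun z => u z.1 * ‖z.1 - z.2‖ ^ (-α) * u z.2 with hF
  have hFint : Integrable F (volume.prod volume) := by
    refine (integrable_prod_rieszKernel u u h0 h3).congr (Eventually.of_forall fun z => ?_)
    simp only [hF]; ring
  have hFm : Measurable F := by
    simp only [hF]
    fun_prop
  -- Step 1: `|∫∫ F| = |∫ F d(x,y)| ≤ (∫⁻ ‖F‖ₑ).toReal`
  have hiter : ∫ x, ∫ y, u x * ‖x - y‖ ^ (-α) * u y = ∫ z, F z ∂(volume.prod volume) := by
    rw [integral_prod F hFint]
  have habs : |∫ x, ∫ y, u x * ‖x - y‖ ^ (-α) * u y| ≤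
      (∫⁻ z, ENNReal.ofReal ‖F z‖ ∂(volume.prod volume)).toReal := by
    rw [hiter, ← Real.norm_eq_abs]
    exact norm_integral_le_lintegral_norm F
  -- Step 2: pointwise AM–GM bound `‖F(x,y)‖ ≤ ½ K 1_S(y) u(x)² + ½ K 1_S(x) u(y)²`
  set G₁ : EuclideanSpace ℝ (Fin 3) → EuclideanSpace ℝ (Fin 3) → ℝ≥0∞ :=
    fun x y => ENNReal.ofReal ((u x) ^ 2 / 2) * S.indicator (fun y => ENNReal.ofReal (‖x - y‖ ^ (-α))) y with hG₁
  set G₂ : EuclideanSpace ℝ (Fin 3) → EuclideanSpace ℝ (Fin 3) → ℝ≥0∞ :=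
    fun x y => ENNReal.ofReal ((u y) ^ 2 / 2) * S.indicator (fun x => ENNReal.ofReal (‖x - y‖ ^ (-α))) x with hG₂
  have hpt : ∀ x y, ENNReal.ofReal ‖F (x, y)‖ ≤ G₁ x y + G₂ x y := by
    intro x y
    by_cases hx : x ∈ S
    · by_cases hy : y ∈ S
      · simp only [hG₁, hG₂, indicator_of_mem hx, indicator_of_mem hy, hF]
        rw [← ENNReal.ofReal_mul (by positivity), ← ENNReal.ofReal_mul (by positivity),
          ← ENNReal.ofReal_add (by positivity) (by positivity)]
        refine ENNReal.ofReal_le_ofReal ?_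
        rw [Real.norm_eq_abs, abs_mul, abs_mul, abs_of_nonneg (hK0 _)]
        have hk := hK0 (x - y)
        nlinarith [sq_nonneg (|u x| - |u y|), sq_abs (u x), sq_abs (u y), abs_nonneg (u x),
          abs_nonneg (u y), mul_nonneg (mul_nonneg (abs_nonneg (u x)) (abs_nonneg (u y))) hk]
      · have : F (x, y) = 0 := by simp only [hF, hu0 y hy, mul_zero]
        rw [this, norm_zero, ENNReal.ofReal_zero]
        exact zero_le
    · have : F (x, y) = 0 := by simp only [hF, hu0 x hx, zero_mul]
      rw [this, norm_zero, ENNReal.ofReal_zero]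
      exact zero_le
  -- Step 3: Tonelli and the uniform potential bound on each half
  have hpot : ∀ x ∈ S, ∫⁻ y, S.indicator (fun y => ENNReal.ofReal (‖x - y‖ ^ (-α))) y ≤ ENNReal.ofReal C := by
    intro x hx
    rw [lintegral_indicator measurableSet_closedBall]
    exact lintegral_closedBall_rieszKernel_le h3 hx
  have hpot' : ∀ y ∈ S, ∫⁻ x, S.indicator (fun x => ENNReal.ofReal (‖x - y‖ ^ (-α))) x ≤ ENNReal.ofReal C := by
    intro y hy
    have h := hpot y hy
    rw [lintegral_indicator measurableSet_closedBall] at h ⊢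
    refine le_trans (le_of_eq (setLIntegral_congr_fun measurableSet_closedBall fun x _ => ?_)) h
    rw [norm_sub_rev]
  have hmeasK : Measurable fun p : EuclideanSpace ℝ (Fin 3) × EuclideanSpace ℝ (Fin 3) =>
      ENNReal.ofReal (‖p.1 - p.2‖ ^ (-α)) := by fun_prop
  have hG₁m : Measurable (Function.uncurry G₁) := by
    simp only [hG₁, Function.uncurry_def]
    refine Measurable.mul (by fun_prop) ?_
    exact (Measurable.indicator hmeasK (measurableSet_closedBall.preimage measurable_snd) :
      Measurable fun p : EuclideanSpace ℝ (Fin 3) × EuclideanSpace ℝ (Fin 3) =>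
        S.indicator (fun y => ENNReal.ofReal (‖p.1 - y‖ ^ (-α))) p.2)
  have hG₂m : Measurable (Function.uncurry G₂) := by
    simp only [hG₂, Function.uncurry_def]
    refine Measurable.mul (by fun_prop) ?_
    exact (Measurable.indicator hmeasK (measurableSet_closedBall.preimage measurable_fst) :
      Measurable fun p : EuclideanSpace ℝ (Fin 3) × EuclideanSpace ℝ (Fin 3) =>
        S.indicator (fun x => ENNReal.ofReal (‖x - p.2‖ ^ (-α))) p.1)
  have hsq_int : Integrable fun x => (u x) ^ 2 := by
    have := u.memLp 2 (μ := (volume : Measure (EuclideanSpace ℝ (Fin 3))))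
    simpa using this.integrable_sq
  have hsq0 : 0 ≤ ∫ x, (u x) ^ 2 := integral_nonneg fun x => sq_nonneg _
  have hhalf : ∫⁻ x, ENNReal.ofReal ((u x) ^ 2 / 2) = ENNReal.ofReal ((∫ x, (u x) ^ 2) / 2) := by
    rw [← integral_div, ofReal_integral_eq_lintegral_ofReal (hsq_int.div_const 2)
      (Eventually.of_forall fun x => by positivity)]
  -- first half
  have hT₁ : ∫⁻ x, ∫⁻ y, G₁ x y ≤ ENNReal.ofReal C * ENNReal.ofReal ((∫ x, (u x) ^ 2) / 2) := by
    calc ∫⁻ x, ∫⁻ y, G₁ x y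
        = ∫⁻ x, ENNReal.ofReal ((u x) ^ 2 / 2) * ∫⁻ y, S.indicator (fun y => ENNReal.ofReal (‖x - y‖ ^ (-α))) y := by
          refine lintegral_congr fun x => ?_
          have hm : Measurable fun y => S.indicator (fun y => ENNReal.ofReal (‖x - y‖ ^ (-α))) y :=
            (hmeasK.comp (measurable_const.prodMk measurable_id)).indicator measurableSet_closedBall
          simp only [hG₁]
          rw [lintegral_const_mul _ hm]
      _ ≤ ∫⁻ x, ENNReal.ofReal ((u x) ^ 2 / 2) * ENNReal.ofReal C := by
          refine lintegral_mono fun x => ?_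
          by_cases hx : x ∈ S
          · gcongr
            exact hpot x hx
          · rw [hu0 x hx]; simp
      _ = ENNReal.ofReal C * ENNReal.ofReal ((∫ x, (u x) ^ 2) / 2) := by
          rw [lintegral_mul_const _ (by fun_prop), hhalf, mul_comm]
  -- second half (swap the order of integration first)
  have hT₂ : ∫⁻ x, ∫⁻ y, G₂ x y ≤ ENNReal.ofReal C * ENNReal.ofReal ((∫ x, (u x) ^ 2) / 2) := by
    rw [lintegral_lintegral_swap hG₂m.aemeasurable]
    calc ∫⁻ y, ∫⁻ x, G₂ x y
        = ∫⁻ y, ENNReal.ofReal ((u y) ^ 2 / 2) * ∫⁻ x, S.indicator (fun x => ENNReal.ofReal (‖x - y‖ ^ (-α))) x := by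
          refine lintegral_congr fun y => ?_
          have hm : Measurable fun x => S.indicator (fun x => ENNReal.ofReal (‖x - y‖ ^ (-α))) x :=
            (hmeasK.comp (measurable_id.prodMk measurable_const)).indicator measurableSet_closedBall
          simp only [hG₂]
          rw [lintegral_const_mul _ hm]
      _ ≤ ∫⁻ y, ENNReal.ofReal ((u y) ^ 2 / 2) * ENNReal.ofReal C := by
          refine lintegral_mono fun y => ?_
          by_cases hy : y ∈ S
          · gcongr
            exact hpot' y hy
          · rw [hu0 y hy]; simp
      _ = ENNReal.ofReal C * ENNReal.ofReal ((∫ x, (u x) ^ 2) / 2) := by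
          rw [lintegral_mul_const _ (by fun_prop), hhalf, mul_comm]
  -- Step 4: assemble
  have hbound : ∫⁻ z, ENNReal.ofReal ‖F z‖ ∂(volume.prod volume) ≤
      ENNReal.ofReal (C * ∫ x, (u x) ^ 2) := by
    calc ∫⁻ z, ENNReal.ofReal ‖F z‖ ∂(volume.prod volume)
        = ∫⁻ x, ∫⁻ y, ENNReal.ofReal ‖F (x, y)‖ := lintegral_prod _ (by fun_prop)
      _ ≤ ∫⁻ x, ∫⁻ y, (G₁ x y + G₂ x y) := lintegral_mono fun x => lintegral_mono fun y => hpt x y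
      _ = (∫⁻ x, ∫⁻ y, G₁ x y) + ∫⁻ x, ∫⁻ y, G₂ x y := by
          have hm1 : Measurable fun x => ∫⁻ y, G₁ x y := hG₁m.lintegral_prod_right'
          rw [← lintegral_add_left hm1]
          refine lintegral_congr fun x => ?_
          have hm2 : Measurable (G₁ x) := hG₁m.of_uncurry_left
          exact lintegral_add_left hm2 _
      _ ≤ ENNReal.ofReal C * ENNReal.ofReal ((∫ x, (u x) ^ 2) / 2) +
            ENNReal.ofReal C * ENNReal.ofReal ((∫ x, (u x) ^ 2) / 2) := add_le_add hT₁ hT₂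
      _ = ENNReal.ofReal (C * ∫ x, (u x) ^ 2) := by
          rw [← ENNReal.ofReal_mul hC0, ← ENNReal.ofReal_add (by positivity) (by positivity)]
          congr 1
          ring
  calc |∫ x, ∫ y, u x * ‖x - y‖ ^ (-α) * u y|
      ≤ (∫⁻ z, ENNReal.ofReal ‖F z‖ ∂(volume.prod volume)).toReal := habs
    _ ≤ (ENNReal.ofReal (C * ∫ x, (u x) ^ 2)).toReal :=
        ENNReal.toReal_mono ENNReal.ofReal_ne_top hbound
    _ = C * ∫ x, (u x) ^ 2 := ENNReal.toReal_ofReal (mul_nonneg hC0 hsq0)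

end Literature.Analysis.Potential

end
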